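/-
Copyright: seat `ym-line-sll-p3` (prover-ym-line-sll-p3-g0-0), route `SoftLoopLongLag`, crux `SoftLoopLagFloorToTorus`
(stmt-QuantumFields-22504), line `birth` (v3: stub K2 `stub_meanSmoothG`).
-/
import Summits.QuantumFields.YangMills.Theorems.SoftLoopLongLagColdBoxInnerMixtureG

/-!
# Crux `SoftLoopLagFloorToTorus` (stmt-QuantumFields-22504), line `birth` — K2 BY MIXTURE: the same-datum conditional-mean smoothness of the
# OUTER cold-conditioned kernel from the inner DATUM mean smoothness (E2) of the cube geometry, for EVERY compact gauge group

WHAT.  `condMeanSmooth_of_innerMixture`.  Parameters `ε b a κ K` with `0 < ε`, `0 < κ`, `0 < b < a`; `R = ⌈β^ε⌉`, `n = ⌈β^a⌉` (outer lag box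
`Λ_n`), `H = ⌈β^b⌉` (inner cube `Λ₀ = boxEdges 4 (2H+1)` of `ColdBoxAllGroups`, kernel `boxKernelG r.ρ β H ζ`),
`F_H = F_R ∘ configShift (−boxCentre H)`, `hot′ = (coldEvent r β (2κ) Λ₀)ᶜ`.  INPUT (hypothesis, `∃ β₀`-form) — (E2) inner datum mean smoothness:
for `β ≥ β₀` and every `ζ` with `CrudeGoodG r.ρ β (κ/2) H ζ` and `γ_{Λ₀}(hot′|ζ) ≤ e^{−β^{κ/8}}`,
`|∫ F_H∘α_R dγ_{Λ₀}(·|ζ) − ∫ F_H dγ_{Λ₀}(·|ζ)| ≤ K·R⁸·β^{κ−1}/H`.  CONCLUSION: `∃ β₀, ∀ β ≥ β₀, ∀ η` with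
`γ_{Λ_n}(coldᶜ|η) ≤ e^{−β^{κ/4}}` (cold = threshold `β^{κ−1}`):
`|condMean r β κ n (F_R∘α_R) η − condMean r β κ n F_R η| ≤ (2|K| + 1)·R⁸·β^{κ−1}/H`
— the K2-shape input of the transfer K1 with the INNER box `H` and the cold scale `β^{κ−1}` in place of `(n, β^{2δ−1})`.

PROOF.  With `μ = γ_{Λ_n}(·|η)`, `ν = μ[|cold]`, `h, k` the `γ_{Λ'}(·|ζ)`-means of `F_R`, `F_R∘α_R` over the centred cube `Λ' ⊆ Λ_n`:
`μ(F_R∘α_R) − μ(F_R) = ∫ (k − h) dμ` (DLR consistency in `ℤ⁴`, `integral_ymSpecification_consistent`); off the exceptional set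
`coldᶜ ∪ {γ_{Λ'}(hot″|ζ) > e^{−β^{κ/8}}}` of `μ`-mass `p ≤ 2e^{−β^{κ/8}}` (Markov + consistency, exactly as in `coldBoxFloor_of_innerMixture`) (E2) gives
`|k − h| ≤ |K|R⁸β^{κ−1}/H` through the translation bridge (`integral_innerKernel_eq`), and `|k − h| ≤ 2B` on it, so
`|μ(F_R∘α_R) − μ(F_R)| ≤ |K|R⁸β^{κ−1}/H + 2Bp`; removing the conditioning,
`ν g = (μ g − ∫_{coldᶜ} g dμ)/μ(cold)` (`integral_eq_measureReal_mul_integral_cond_add`) with `μ(cold) ≥ 1/2` gives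
`|ν(F_R∘α_R) − ν(F_R)| ≤ 2(|K|R⁸β^{κ−1}/H + 2Bp + 2Be^{−β^{κ/4}})`, and the exponentially small terms are `≤ R⁸β^{κ−1}/H` eventually.

HONEST LABEL: rung R2xi-G RECORD label (leaf `WeakCouplingRates.XiPow`, an UPPER bound on the lattice mass gap for every compact simple `G`); NOT the
Clay mass gap; no summit statement is touched.  No analysis: (E2) is a hypothesis (the one-scale engine of `ColdBoxAllGroups`).

References: H.-O. Georgii, *Gibbs Measures and Phase Transitions* (2011) Def. 1.23 (iii), §5.1 (5.8); R. Durrett (2019) §4.1.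
-/

set_option autoImplicit false

noncomputable section

open MeasureTheory Filter Topology
open Literature.Probability.LatticeModels (Site box mem_box box_mono)
open Literature.MathematicalPhysics Literature.MathematicalPhysics.QuantumFieldTheory
open Literature.MathematicalPhysics.QuantumLattice
open Summit.QuantumFields.YangMills.Theorems.WeakCouplingRates
open Summit.QuantumFields.YangMills.Theorems.ColdBoxAllGroups (CrudeGoodG boxKernelG)

namespace Summit.QuantumFields.YangMills.Theorems.SoftLoopLongLag

/-- **Means through conditioning, solved for the conditioned side**: for `γ(A) ≠ 0`, `|F|, |G| ≤ B`,
`γ(A)·(γ[|A] G − γ[|A] F) = (γ G − γ F) − (∫_{Aᶜ} G dγ − ∫_{Aᶜ} F dγ)`, hence `γ(A)·|γ[|A] G − γ[|A] F| ≤ |γ G − γ F| + 2B·γ(Aᶜ)`. [folklore] -/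
theorem measureReal_mul_abs_cond_sub_le {Ω : Type*} [MeasurableSpace Ω] {γ : Measure Ω} [IsProbabilityMeasure γ] {A : Set Ω}
    (hA : MeasurableSet A) (hA0 : γ A ≠ 0) {F G : Ω → ℝ} (hFm : Measurable F) (hGm : Measurable G) {B : ℝ}
    (hFB : ∀ ω, |F ω| ≤ B) (hGB : ∀ ω, |G ω| ≤ B) :
    γ.real A * |(∫ ω, G ω ∂(ProbabilityTheory.cond γ A)) - ∫ ω, F ω ∂(ProbabilityTheory.cond γ A)| ≤
      |(∫ ω, G ω ∂γ) - ∫ ω, F ω ∂γ| + 2 * B * γ.real Aᶜ := by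
  have bdd : ∀ {f : Ω → ℝ} (C : ℝ), Measurable f → (∀ ω, |f ω| ≤ C) → Integrable f γ := fun C hf hC =>
    Integrable.of_bound hf.aestronglyMeasurable C (ae_of_all _ fun ω => by simpa [Real.norm_eq_abs] using hC ω)
  have tail : ∀ (f : Ω → ℝ) (C : ℝ), (∀ ω, |f ω| ≤ C) → |∫ ω in Aᶜ, f ω ∂γ| ≤ C * γ.real Aᶜ := fun f C hC => by
    have h := norm_setIntegral_le_of_norm_le_const (μ := γ) (s := Aᶜ) (f := f) (C := C) (measure_lt_top γ _)
      (fun ω _ => by rw [Real.norm_eq_abs]; exact hC ω)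
    simpa [Real.norm_eq_abs] using h
  have eF := integral_eq_measureReal_mul_integral_cond_add hA hA0 (bdd B hFm hFB)
  have eG := integral_eq_measureReal_mul_integral_cond_add hA hA0 (bdd B hGm hGB)
  have hrF := tail F B hFB
  have hrG := tail G B hGB
  have hpc0 : 0 ≤ γ.real A := measureReal_nonneg
  rw [← abs_of_nonneg hpc0, ← abs_mul, mul_sub]
  have e : γ.real A * (∫ ω, G ω ∂(ProbabilityTheory.cond γ A)) - γ.real A * ∫ ω, F ω ∂(ProbabilityTheory.cond γ A) =
      ((∫ ω, G ω ∂γ) - ∫ ω, F ω ∂γ) - ((∫ ω in Aᶜ, G ω ∂γ) - ∫ ω in Aᶜ, F ω ∂γ) := by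
    rw [eF, eG]; ring
  rw [e]
  calc |((∫ ω, G ω ∂γ) - ∫ ω, F ω ∂γ) - ((∫ ω in Aᶜ, G ω ∂γ) - ∫ ω in Aᶜ, F ω ∂γ)|
      ≤ |(∫ ω, G ω ∂γ) - ∫ ω, F ω ∂γ| + |(∫ ω in Aᶜ, G ω ∂γ) - ∫ ω in Aᶜ, F ω ∂γ| := abs_sub _ _
    _ ≤ |(∫ ω, G ω ∂γ) - ∫ ω, F ω ∂γ| + (|∫ ω in Aᶜ, G ω ∂γ| + |∫ ω in Aᶜ, F ω ∂γ|) :=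
        add_le_add le_rfl (abs_sub _ _)
    _ ≤ |(∫ ω, G ω ∂γ) - ∫ ω, F ω ∂γ| + 2 * B * γ.real Aᶜ := by linarith

/-- **K2 by mixture — the same-datum conditional-mean smoothness of the outer cold-conditioned kernel from the inner datum mean smoothness (E2)**
(see the module docstring).  Every compact `G`; `0 < b < a`; conclusion for cold-typical data `η` (`γ_{Λ_n}(coldᶜ|η) ≤ e^{−β^{κ/4}}`):
`|condMean r β κ n (F_R∘α_R) η − condMean r β κ n F_R η| ≤ (2|K|+1)·R⁸·β^{κ−1}/H`. [folklore] -/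
theorem condMeanSmooth_of_innerMixture :
    ∀ (G : Type) [Group G] [TopologicalSpace G] [IsTopologicalGroup G] [CompactSpace G] [MeasurableSpace G] [BorelSpace G]
      (r : LatticeRep G) (ε b a κ K : ℝ), 0 < ε → 0 < κ → 0 < b → b < a →
      (∃ β₀ : ℝ, ∀ β : ℝ, β₀ ≤ β → ∀ ζ : LGConfig 4 G, CrudeGoodG r.ρ β (κ / 2) ⌈β ^ b⌉₊ ζ →
          boxKernelG r.ρ β ⌈β ^ b⌉₊ ζ (coldEvent r β (2 * κ) (AxialGauge.boxEdges 4 (2 * ⌈β ^ b⌉₊ + 1)))ᶜ ≤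
            ENNReal.ofReal (Real.exp (-(β ^ (κ / 8)))) →
          |(∫ U, softLoopObs r ⌈β ^ ε⌉₊ (configShift (-(boxCentre ⌈β ^ b⌉₊)) (timeShiftLG (G := G) ⌈β ^ ε⌉₊ U))
                ∂(boxKernelG r.ρ β ⌈β ^ b⌉₊ ζ)) -
              ∫ U, softLoopObs r ⌈β ^ ε⌉₊ (configShift (-(boxCentre ⌈β ^ b⌉₊)) U) ∂(boxKernelG r.ρ β ⌈β ^ b⌉₊ ζ)|
            ≤ K * (⌈β ^ ε⌉₊ : ℝ) ^ 8 * β ^ (κ - 1) / (⌈β ^ b⌉₊ : ℝ)) →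
      ∃ β₀ : ℝ, ∀ β : ℝ, β₀ ≤ β → ∀ η : LGConfig 4 G,
        ymSpecification (d := 4) r.ρ β (lagBox ⌈β ^ a⌉₊) η (coldEvent r β κ (lagBox ⌈β ^ a⌉₊))ᶜ ≤
          ENNReal.ofReal (Real.exp (-(β ^ (κ / 4)))) →
        |condMean r β κ ⌈β ^ a⌉₊ (fun U => softLoopObs r ⌈β ^ ε⌉₊ (timeShiftLG (G := G) ⌈β ^ ε⌉₊ U)) η -
            condMean r β κ ⌈β ^ a⌉₊ (softLoopObs r ⌈β ^ ε⌉₊) η|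
          ≤ (2 * |K| + 1) * (⌈β ^ ε⌉₊ : ℝ) ^ 8 * β ^ (κ - 1) / (⌈β ^ b⌉₊ : ℝ) := by
  intro G _ _ _ _ _ _ r ε b a κ K hε hκ hb hba hE2
  obtain ⟨β₂, hE2⟩ := hE2
  haveI : SecondCountableTopology G := r.secondCountableTopology
  have hab : 0 < a - b := by linarith
  -- thresholds: the inner cube fits, `β^{κ/8} ≥ 2`, and the exponential junk is below the polynomial scale
  have hT1 : ∀ᶠ β : ℝ in atTop, (4 : ℝ) ≤ β ^ (a - b) := (tendsto_rpow_atTop hab).eventually_ge_atTop 4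
  have hT4 : ∀ᶠ β : ℝ in atTop, (2 : ℝ) ≤ β ^ (κ / 8) := (tendsto_rpow_atTop (by positivity : 0 < κ / 8)).eventually_ge_atTop 2
  have hT3 : ∀ᶠ β : ℝ in atTop, 30000 * (β ^ (4 * ε + b + 1) * Real.exp (-(β ^ (κ / 8)))) ≤ 1 := by
    have ht := (tendsto_rpow_mul_exp_neg_rpow (4 * ε + b + 1) (by positivity : 0 < κ / 8)).const_mul (30000 : ℝ)
    rw [mul_zero] at ht
    exact ht.eventually (eventually_le_nhds one_pos)
  obtain ⟨β₅, hβ₅⟩ := Filter.eventually_atTop.1 (hT1.and (hT4.and hT3))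
  refine ⟨max β₂ (max β₅ 2), fun β hβ η hcold => ?_⟩
  simp only [max_le_iff] at hβ
  obtain ⟨hb2, hb5, hb7⟩ := hβ
  have hb6 : (1 : ℝ) ≤ β := by linarith
  have hβ0 : 0 < β := by linarith
  obtain ⟨hA1, hA4, hA3⟩ := hβ₅ β hb5
  set R : ℕ := ⌈β ^ ε⌉₊ with hR
  set n : ℕ := ⌈β ^ a⌉₊ with hn
  set H : ℕ := ⌈β ^ b⌉₊ with hH
  simp only [condMean, coldKernel]
  -- sizes
  have hu1 : 1 ≤ β ^ ε := Real.one_le_rpow hb6 hε.le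
  have hu0 : 0 < β ^ ε := by positivity
  have hRge : β ^ ε ≤ (R : ℝ) := Nat.le_ceil _
  have hRle : (R : ℝ) ≤ 2 * β ^ ε := (one_le_ceil_rpow_and_le hb6 hε.le).2
  have hvb1 : 1 ≤ β ^ b := Real.one_le_rpow hb6 hb.le
  have hvb0 : 0 < β ^ b := by positivity
  have hHge : β ^ b ≤ (H : ℝ) := Nat.le_ceil _
  have hHle : (H : ℝ) ≤ 2 * β ^ b := (one_le_ceil_rpow_and_le hb6 hb.le).2
  have hH0 : (0 : ℝ) < H := lt_of_lt_of_le hvb0 hHge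
  have hnge : β ^ a ≤ (n : ℝ) := Nat.le_ceil _
  have hHn : H + 2 ≤ n := by
    have hsplit : β ^ a = β ^ (a - b) * β ^ b := by rw [← Real.rpow_add hβ0]; ring_nf
    have h4 : 4 * β ^ b ≤ β ^ a := by rw [hsplit]; exact mul_le_mul_of_nonneg_right hA1 hvb0.le
    have h1 : (H : ℝ) + 2 ≤ (n : ℝ) := by linarith
    exact_mod_cast h1
  set B : ℝ := (2 * (R : ℝ) + 1) ^ 4 with hB
  have hB0 : 0 ≤ B := by positivity
  have hBle : B ≤ 625 * (β ^ ε) ^ 4 := by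
    have h5 : 2 * (R : ℝ) + 1 ≤ 5 * β ^ ε := by linarith
    calc B = (2 * (R : ℝ) + 1) ^ 4 := hB
      _ ≤ (5 * β ^ ε) ^ 4 := pow_le_pow_left₀ (by positivity) h5 4
      _ = 625 * (β ^ ε) ^ 4 := by ring
  set e' : ℝ := Real.exp (-(β ^ (κ / 8))) with he'def
  set eo : ℝ := Real.exp (-(β ^ (κ / 4))) with heodef
  have he'0 : 0 < e' := Real.exp_pos _
  have heo0 : 0 < eo := Real.exp_pos _
  have he'1 : e' ≤ 1 := by rw [he'def]; exact Real.exp_le_one_iff.2 (by simp [Real.rpow_nonneg hβ0.le])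
  have heoe' : eo / e' ≤ e' := by
    rw [div_le_iff₀ he'0, heodef, he'def, ← Real.exp_add]
    refine Real.exp_le_exp.2 ?_
    have hsq : β ^ (κ / 4) = β ^ (κ / 8) * β ^ (κ / 8) := by rw [← Real.rpow_add hβ0]; ring_nf
    have hu0' : 0 ≤ β ^ (κ / 8) := by positivity
    have h2u : 2 * β ^ (κ / 8) ≤ β ^ (κ / 8) * β ^ (κ / 8) := mul_le_mul_of_nonneg_right hA4 hu0'
    linarith
  have heo_le : eo ≤ e' := by
    have h1 : eo ≤ eo / e' := by
      rw [le_div_iff₀ he'0]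
      exact mul_le_of_le_one_right heo0.le he'1
    exact h1.trans heoe'
  set p : ℝ := eo + eo / e' with hp
  have hp0 : 0 ≤ p := by positivity
  have hp2 : p ≤ 2 * e' := by rw [hp]; linarith
  -- the polynomial scale and the junk
  set S : ℝ := (R : ℝ) ^ 8 * β ^ (κ - 1) / (H : ℝ) with hS
  have hS0 : 0 ≤ S := by positivity
  have hJ : 2 * (2 * B * p + 2 * B * eo) ≤ S := by
    -- `2(2Bp + 2Beo) ≤ 12 B e' ≤ 7500 (β^ε)^4 e'` and `S ≥ β^{κ-1}/(2β^b)`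
    have h1 : 2 * (2 * B * p + 2 * B * eo) ≤ 12 * B * e' := by
      have t1 := mul_le_mul_of_nonneg_left hp2 (show 0 ≤ 4 * B by positivity)
      have t2 := mul_le_mul_of_nonneg_left heo_le (show 0 ≤ 4 * B by positivity)
      linarith
    have h2 : 12 * B * e' ≤ 7500 * (β ^ ε) ^ 4 * e' := by
      have t := mul_le_mul_of_nonneg_right hBle (show 0 ≤ 12 * e' by positivity)
      linarith
    have hR8 : (1 : ℝ) ≤ (R : ℝ) ^ 8 := one_le_pow₀ (hu1.trans hRge)
    have hs1 : β ^ (κ - 1) / (2 * β ^ b) ≤ S := by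
      rw [hS]
      have hk0 : 0 ≤ β ^ (κ - 1) := Real.rpow_nonneg hβ0.le _
      calc β ^ (κ - 1) / (2 * β ^ b) ≤ β ^ (κ - 1) / (H : ℝ) := div_le_div_of_nonneg_left hk0 hH0 hHle
        _ = 1 * β ^ (κ - 1) / (H : ℝ) := by rw [one_mul]
        _ ≤ (R : ℝ) ^ 8 * β ^ (κ - 1) / (H : ℝ) := by gcongr
    -- `7500 (β^ε)^4 e' ≤ β^{κ-1}/(2β^b)` from `30000 β^{4ε+b+1} e' ≤ 1` and `β^{-1} ≤ β^{κ-1}`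
    have hid : (β ^ ε) ^ 4 * β ^ b * β = β ^ (4 * ε + b + 1) := by
      rw [← Real.rpow_natCast (β ^ ε) 4, ← Real.rpow_mul hβ0.le, ← Real.rpow_add hβ0, Real.rpow_add_one hβ0.ne']
      have e4 : ε * ((4 : ℕ) : ℝ) + b = 4 * ε + b := by push_cast; ring
      rw [e4]
    have hkm1 : β ^ (-(1 : ℝ)) ≤ β ^ (κ - 1) := Real.rpow_le_rpow_of_exponent_le hb6 (by linarith)
    have hβinv : β ^ (-(1 : ℝ)) = β⁻¹ := Real.rpow_neg_one β
    have h3 : 7500 * (β ^ ε) ^ 4 * e' ≤ β ^ (κ - 1) / (2 * β ^ b) := by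
      rw [le_div_iff₀ (by positivity)]
      have h4 : 7500 * (β ^ ε) ^ 4 * e' * (2 * β ^ b) * β ≤ 1 / 2 := by
        have : 7500 * (β ^ ε) ^ 4 * e' * (2 * β ^ b) * β = 15000 * (β ^ (4 * ε + b + 1) * e') := by
          rw [← hid]; ring
        rw [this]; linarith
      have h5 : (1 : ℝ) / 2 ≤ β ^ (κ - 1) * β := by
        have h6 : β⁻¹ * β = 1 := inv_mul_cancel₀ hβ0.ne'
        have h7 : β⁻¹ ≤ β ^ (κ - 1) := by rw [← hβinv]; exact hkm1
        have h8 := mul_le_mul_of_nonneg_right h7 hβ0.le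
        rw [h6] at h8
        linarith
      have hXβ : 7500 * (β ^ ε) ^ 4 * e' * (2 * β ^ b) * β ≤ β ^ (κ - 1) * β := by linarith
      exact le_of_mul_le_mul_right hXβ hβ0
    linarith
  -- the outer kernel and the inner cube
  set Λ : Finset (QuantumLattice.ZdEdge 4) := lagBox n with hΛ
  set Λ₀ : Finset (QuantumLattice.ZdEdge 4) := AxialGauge.boxEdges 4 (2 * H + 1) with hΛ₀
  set bc : Site 4 := boxCentre H with hbc
  set Λ' : Finset (QuantumLattice.ZdEdge 4) := Λ₀.map (edgeShift (-bc)).toEmbedding with hΛ'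
  have hsub : Λ' ⊆ Λ := centredCube_subset_lagBox (by omega)
  set μ : Measure (LGConfig 4 G) := ymSpecification (d := 4) r.ρ β Λ η with hμ
  haveI : IsProbabilityMeasure μ := isProbabilityMeasure_ymSpecification r.ρ r.continuous β Λ η
  set F : LGConfig 4 G → ℝ := softLoopObs r R with hF
  have hFc : Continuous F := continuous_softLoopObs r R
  have hFc' : Continuous fun U => F (timeShiftLG (G := G) R U) := hFc.comp (continuous_timeShiftLG R)
  have hFK : ∀ U, |F U| ≤ B := abs_softLoopObs_le' r R
  have hFK' : ∀ U, |F (timeShiftLG (G := G) R U)| ≤ B := fun U => abs_softLoopObs_le' r R _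
  set h : LGConfig 4 G → ℝ := fun ζ => ∫ W, F W ∂(ymSpecification (d := 4) r.ρ β Λ' ζ) with hh
  set k : LGConfig 4 G → ℝ := fun ζ => ∫ W, F (timeShiftLG (G := G) R W) ∂(ymSpecification (d := 4) r.ρ β Λ' ζ) with hk
  have hhm : Measurable h := (continuous_integral_ymSpecification r.ρ r.continuous β Λ' hFc hFK).measurable
  have hkm : Measurable k := (continuous_integral_ymSpecification r.ρ r.continuous β Λ' hFc' hFK').measurable
  have hhK : ∀ ζ, |h ζ| ≤ B := fun ζ => abs_integral_ymSpecification_le r.ρ r.continuous β Λ' hFK _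
  have hkK : ∀ ζ, |k ζ| ≤ B := fun ζ => abs_integral_ymSpecification_le r.ρ r.continuous β Λ' hFK' _
  have hch : ∫ ζ, h ζ ∂μ = ∫ W, F W ∂μ := integral_ymSpecification_consistent r β hsub η hFc.measurable hFK
  have hck : ∫ ζ, k ζ ∂μ = ∫ W, F (timeShiftLG (G := G) R W) ∂μ :=
    integral_ymSpecification_consistent r β hsub η hFc'.measurable hFK'
  -- the exceptional set and its mass (as in `coldBoxFloor_of_innerMixture`)
  set cold : Set (LGConfig 4 G) := coldEvent r β κ Λ with hcolddef
  set hot'' : Set (LGConfig 4 G) := {U | configShift bc U ∉ coldEvent r β (2 * κ) Λ₀} with hhot''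
  have hcoldm : MeasurableSet cold := measurableSet_coldEvent r β κ Λ
  have hhot''m : MeasurableSet hot'' := measurableSet_innerHot_shift r β κ H
  set g₂ : LGConfig 4 G → ℝ := fun ζ => (ymSpecification (d := 4) r.ρ β Λ' ζ).real hot'' with hg₂
  have hg₂m : Measurable g₂ := (measurable_ymSpecification_apply r.ρ r.continuous β Λ' hhot''m).ennreal_toReal
  set E : Set (LGConfig 4 G) := coldᶜ ∪ {ζ | e' < g₂ ζ} with hE
  have hEm : MeasurableSet E := hcoldm.compl.union (measurableSet_lt measurable_const hg₂m)
  have hcold_real : μ.real coldᶜ ≤ eo := by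
    rw [measureReal_def]
    exact ENNReal.toReal_le_of_le_ofReal heo0.le hcold
  have hhot''sub : hot'' ⊆ coldᶜ := fun U hU => not_mem_coldEvent_of_innerHot r hb6 hκ.le (by omega) hU
  have hμE : μ.real E ≤ p := by
    have h2 : μ.real {ζ | e' < g₂ ζ} ≤ eo / e' := by
      have hg0 : ∀ ζ, 0 ≤ g₂ ζ := fun ζ => measureReal_nonneg
      have hg1 : ∀ ζ, |g₂ ζ| ≤ 1 := fun ζ => by
        haveI := isProbabilityMeasure_ymSpecification r.ρ r.continuous β Λ' ζ
        rw [abs_of_nonneg (hg0 ζ)]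
        exact measureReal_le_one
      have hgi : Integrable g₂ μ :=
        Integrable.of_bound hg₂m.aestronglyMeasurable 1 (ae_of_all _ fun ζ => by rw [Real.norm_eq_abs]; exact hg1 ζ)
      have hmarkov : e' * μ.real {ζ | e' ≤ g₂ ζ} ≤ ∫ ζ, g₂ ζ ∂μ := mul_meas_ge_le_integral_of_nonneg (ae_of_all _ hg0) hgi e'
      have hmono : μ.real {ζ | e' < g₂ ζ} ≤ μ.real {ζ | e' ≤ g₂ ζ} := measureReal_mono fun ζ (hζ : e' < g₂ ζ) => hζ.le
      have hint : ∫ ζ, g₂ ζ ∂μ ≤ eo := by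
        rw [hg₂, measureReal_ymSpecification_consistent r β hsub η hhot''m]
        exact (measureReal_mono hhot''sub).trans hcold_real
      have hmono' := mul_le_mul_of_nonneg_left hmono he'0.le
      rw [le_div_iff₀ he'0, mul_comm]
      linarith
    calc μ.real E ≤ μ.real coldᶜ + μ.real {ζ | e' < g₂ ζ} := measureReal_union_le _ _
      _ ≤ eo + eo / e' := add_le_add hcold_real h2
  -- off the exceptional set: (E2) through the translation bridge
  set ε₀ : ℝ := |K| * S with hε₀
  have hdiff : ∀ ζ, ζ ∉ E → |k ζ - h ζ| ≤ ε₀ := by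
    intro ζ hζ
    have hζc : ζ ∈ cold := by
      by_contra h'
      exact hζ (Set.mem_union_left _ h')
    have hζ2 : g₂ ζ ≤ e' := not_lt.1 fun h' => hζ (Set.mem_union_right _ h')
    have hgood : CrudeGoodG r.ρ β (κ / 2) H (configShift bc ζ) := crudeGoodG_configShift_of_mem_coldEvent r (by omega) hζc
    haveI := isProbabilityMeasure_ymSpecification r.ρ r.continuous β Λ₀ (configShift bc ζ)
    have htyp : boxKernelG r.ρ β H (configShift bc ζ) (coldEvent r β (2 * κ) (AxialGauge.boxEdges 4 (2 * H + 1)))ᶜ ≤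
        ENNReal.ofReal e' := by
      have hreal : (ymSpecification (d := 4) r.ρ β Λ₀ (configShift bc ζ)).real
          (coldEvent r β (2 * κ) (AxialGauge.boxEdges 4 (2 * H + 1)))ᶜ ≤ e' := by
        rw [innerKernel_real_preimage_eq r β Λ₀ bc ζ (measurableSet_coldEvent r β (2 * κ) _).compl]
        exact hζ2
      show ymSpecification (d := 4) r.ρ β Λ₀ (configShift bc ζ) _ ≤ _
      rw [← ofReal_measureReal (measure_ne_top _ _)]
      exact ENNReal.ofReal_le_ofReal hreal
    have h2 := hE2 β hb2 _ hgood htyp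
    have hcomm : ∀ W : LGConfig 4 G,
        timeShiftLG (G := G) R (configShift (-bc) W) = configShift (-bc) (timeShiftLG (G := G) R W) := fun W =>
      configShift_comm _ _ W
    have eh : h ζ = ∫ W, F (configShift (-bc) W) ∂(ymSpecification (d := 4) r.ρ β Λ₀ (configShift bc ζ)) :=
      integral_innerKernel_eq r β Λ₀ bc ζ F
    have ek : k ζ = ∫ W, F (configShift (-bc) (timeShiftLG (G := G) R W)) ∂(ymSpecification (d := 4) r.ρ β Λ₀ (configShift bc ζ)) := by
      have e := integral_innerKernel_eq r β Λ₀ bc ζ (fun W => F (timeShiftLG (G := G) R W))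
      simp only [hcomm] at e
      exact e
    rw [ek, eh]
    refine (by simpa only [boxKernelG] using h2 :
      |(∫ W, F (configShift (-bc) (timeShiftLG (G := G) R W)) ∂(ymSpecification (d := 4) r.ρ β Λ₀ (configShift bc ζ))) -
          ∫ W, F (configShift (-bc) W) ∂(ymSpecification (d := 4) r.ρ β Λ₀ (configShift bc ζ))| ≤
        K * (R : ℝ) ^ 8 * β ^ (κ - 1) / (H : ℝ)).trans ?_
    rw [hε₀, hS]
    have e1 : K * (R : ℝ) ^ 8 * β ^ (κ - 1) / (H : ℝ) = K * ((R : ℝ) ^ 8 * β ^ (κ - 1) / (H : ℝ)) := by ring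
    rw [e1]
    exact mul_le_mul_of_nonneg_right (le_abs_self K) (by positivity)
  -- `|μ(F∘α) − μ(F)| ≤ ε₀ + 2Bp`
  have bddμ : ∀ {f : LGConfig 4 G → ℝ} (C : ℝ), Measurable f → (∀ ζ, |f ζ| ≤ C) → Integrable f μ := fun C hf hC =>
    Integrable.of_bound hf.aestronglyMeasurable C (ae_of_all _ fun ζ => by simpa [Real.norm_eq_abs] using hC ζ)
  have hmean : |(∫ W, F (timeShiftLG (G := G) R W) ∂μ) - ∫ W, F W ∂μ| ≤ ε₀ + 2 * B * p := by
    rw [← hck, ← hch, ← integral_sub (bddμ B hkm hkK) (bddμ B hhm hhK)]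
    have hpt : ∀ ζ, |k ζ - h ζ| ≤ ε₀ + 2 * B * E.indicator (fun _ => (1 : ℝ)) ζ := by
      intro ζ
      by_cases hζ : ζ ∈ E
      · rw [Set.indicator_of_mem hζ, mul_one]
        have := abs_sub (k ζ) (h ζ)
        have hε₀0 : 0 ≤ ε₀ := by positivity
        linarith [hkK ζ, hhK ζ]
      · rw [Set.indicator_of_notMem hζ, mul_zero, add_zero]
        exact hdiff ζ hζ
    have hint : Integrable (fun ζ => ε₀ + 2 * B * E.indicator (fun _ => (1 : ℝ)) ζ) μ :=
      (integrable_const _).add (((integrable_const _).indicator hEm).const_mul _)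
    calc |∫ ζ, (k ζ - h ζ) ∂μ| ≤ ∫ ζ, |k ζ - h ζ| ∂μ := abs_integral_le_integral_abs
      _ ≤ ∫ ζ, (ε₀ + 2 * B * E.indicator (fun _ => (1 : ℝ)) ζ) ∂μ :=
          integral_mono ((bddμ B hkm hkK).sub (bddμ B hhm hhK)).abs hint hpt
      _ = ε₀ + 2 * B * μ.real E := by
          rw [integral_add (integrable_const _) (((integrable_const _).indicator hEm).const_mul _), integral_const,
            integral_const_mul, integral_indicator_const _ hEm]
          simp
      _ ≤ ε₀ + 2 * B * p := by
          have t := mul_le_mul_of_nonneg_left hμE (show 0 ≤ 2 * B by positivity)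
          linarith
  -- removing the conditioning on the outer cold event
  have heo_lt : eo ≤ 2⁻¹ := by
    have h4 : e' ≤ 2⁻¹ := by
      rw [he'def, Real.exp_neg]
      exact inv_anti₀ (by norm_num) (by linarith [Real.add_one_le_exp (β ^ (κ / 8))])
    exact heo_le.trans h4
  have hpc : 1 - eo ≤ μ.real cold := by
    have h := probReal_compl_eq_one_sub (μ := μ) hcoldm
    linarith
  have hpc2 : 2⁻¹ ≤ μ.real cold := by linarith
  have hA0 : μ cold ≠ 0 := by
    intro h0
    have : μ.real cold = 0 := by rw [measureReal_def, h0, ENNReal.toReal_zero]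
    linarith
  have hcond := measureReal_mul_abs_cond_sub_le (γ := μ) hcoldm hA0 hFc.measurable hFc'.measurable hFK hFK'
  -- `pc·|Δν| ≤ |Δμ| + 2B·eo ≤ ε₀ + 2Bp + 2Beo`, `pc ≥ 1/2`
  have h2B : 2 * B * μ.real coldᶜ ≤ 2 * B * eo := mul_le_mul_of_nonneg_left hcold_real (by positivity)
  have habs0 : 0 ≤ |(∫ W, F (timeShiftLG (G := G) R W) ∂(ProbabilityTheory.cond μ cold)) -
      ∫ W, F W ∂(ProbabilityTheory.cond μ cold)| := abs_nonneg _
  have hfin : |(∫ W, F (timeShiftLG (G := G) R W) ∂(ProbabilityTheory.cond μ cold)) -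
      ∫ W, F W ∂(ProbabilityTheory.cond μ cold)| ≤ 2 * (ε₀ + 2 * B * p + 2 * B * eo) := by
    have t := mul_le_mul_of_nonneg_right hpc2 habs0
    linarith [hcond, hmean, h2B, t]
  have hgoal : 2 * (ε₀ + 2 * B * p + 2 * B * eo) ≤ (2 * |K| + 1) * (R : ℝ) ^ 8 * β ^ (κ - 1) / (H : ℝ) := by
    have e : (2 * |K| + 1) * (R : ℝ) ^ 8 * β ^ (κ - 1) / (H : ℝ) = 2 * (|K| * S) + S := by rw [hS]; ring
    rw [e, ← hε₀]
    linarith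
  exact hfin.trans hgoal

end Summit.QuantumFields.YangMills.Theorems.SoftLoopLongLag

end
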